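import Literature.AlgebraicGeometry.Modules.CechProductCoverKunnethComponents
import Literature.AlgebraicGeometry.Modules.CechProductCoverLexSystemTensor
import Literature.Algebra.Homology.OrderedCechPairSystemKunneth
import HarnessLib

/-!
# Künneth on the product cover for an external tensor product `E ⊠ F`:
# `⨁_{a+b=n} Ȟᵃ(𝓤, E) ⊗ₖ Ȟᵇ(𝓥, F) ≃ Ȟⁿ(W₀, E ⊠ F)`, the Künneth injection, and Künneth vanishing
# (The Stacks Project, Tag 0BEC; Görtz–Wedhorn II, Cor. 22.110; Mumford, *Abelian Varieties*, §8 (vii) and §13)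

Layer `Literature/AlgebraicGeometry/Modules`, namespace `Literature.AlgebraicGeometry.Modules` (§1–§2) with one algebraic lemma in
`Literature.Algebra.Homology.OrderedCech` (§0).  PROOF file (theorems only; no definition, no named fact, no instance, no notation, no
`sorry`).  Cell `hodgecm-mathlib` (D-0151), pay-down programme «H1-DIM in char `p`» (F0P6 RULING «M-25» (2)), file **(K)** of the D1 road
«`H^i(A, M) = 0` for `M ∈ Pic⁰ ∖ 0`» ([MumfordAV1970] §8 (vii)): the MODULE-COEFFICIENT twin of ★ B-p21
`Modules/CechProductCoverKunnethComponents` (which is the case `E = 𝒪_X`, `F = 𝒪_Y`).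

SETTING (the binder block of ★ `Modules/CechProductCoverLexSystemTensor`): a cartesian square `H : IsPullback p q iX iY` (`Z = X ×_S Y`)
over an AFFINE base `S` with `φ : k ≃+* Γ(S, ⊤)`, `k` a field; finite linearly ordered families `𝓤 : ι → X.Opens`, `𝓥 : κ → Y.Opens` with
AFFINE non-empty finite intersections; quasi-coherent (affine-localizing) `E` on `X`, `F` on `Y`; the product cover
`W (i, j) = p⁻¹U_i ∩ q⁻¹V_j` (a BINDER `W` with its shape `hW`, as in the F-J3b files); the three module Čech complexes
`Č(𝓤, E)`, `Č(𝓥, F)`, `Č(W, E ⊠ F)` (★ `Modules.cechComplex`, `E ⊠ F = boxTensor p q E F = p^*E ⊗ q^*F`) over the base rings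
`overRingHom iX φ`, `overRingHom iY φ`, `overRingHom (p ≫ iX) φ`.

* §0 `OrderedCech.injective_homologyMap_tensor_cross` — the Künneth comparison `Hⁿ(Č(M) ⊗ Č(N)) → Hⁿ(Č(lexSystem (M ⊠ N)))` of ★ F-K3 is
  INJECTIVE for any two systems on finite index sets, WITHOUT the finiteness hypothesis of ★ `bijective_homologyMap_tensor_cross` (the cross
  product has the Eilenberg–Zilber retraction ★ `cross_shuffle`);
* §1 **`nonempty_directSum_tensor_linearEquiv_homology_boxTensor`** — `⨁_{a+b=n} Ȟᵃ(𝓤, E) ⊗ₖ Ȟᵇ(𝓥, F) ≃ₗ[k] Ȟⁿ(W, E ⊠ F)` as soon as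
  `Ȟⁿ(W, E ⊠ F)` is finite-dimensional (★ `bijective_homologyMap_comp_kunnethLinearEquiv` on the characterised carrier isomorphism ★
  `exists_sysComplex_lexSystem_prodSystem_iso_cechComplex`); **`exists_injective_directSum_tensor_homology_boxTensor`** — without any
  finiteness, an INJECTIVE `k`-linear map `⨁_{a+b=n} Ȟᵃ(𝓤, E) ⊗ₖ Ȟᵇ(𝓥, F) → Ȟⁿ(W, E ⊠ F)` (§0);
* §2 corollaries in the shape the D1 induction consumes: **`exists_injective_tensor_homology_boxTensor`** (the Künneth injection of ONE
  bidegree `Ȟᵃ(𝓤, E) ⊗ₖ Ȟᵇ(𝓥, F) ↪ Ȟᵃ⁺ᵇ(W, E ⊠ F)`), `subsingleton_tensor_homology_of_subsingleton_homology_boxTensor`, and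
  **`subsingleton_homology_boxTensor_of_forall`** (KÜNNETH VANISHING: if every `Ȟᵃ(𝓤, E) ⊗ₖ Ȟᵇ(𝓥, F)`, `a + b = n`, vanishes and
  `Ȟⁿ(W, E ⊠ F)` is finite-dimensional — e.g. `Z` proper — then `Ȟⁿ(W, E ⊠ F) = 0`).

HC_CM is proved only modulo the 7 printed citations until rung 0 closes — nothing here bears on a summit statement.

## References
* [StacksProject] The Stacks Project, Tag 0BEC (Künneth formula: the Čech complex of the product covering over an affine base), Tag 01FG.
* [GortzWedhorn2023] U. Görtz, T. Wedhorn, *Algebraic Geometry II* (2023), Cor. 22.110 (Künneth formula over a field), Def. 21.68 (p. 180).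
* [Weibel1994] C. A. Weibel, *An introduction to homological algebra* (1994), Thm. 3.6.3 (Künneth formula over a field).
* [EilenbergMacLane1953] S. Eilenberg, S. Mac Lane, *On the groups `H(Π,n)`, I*, Ann. of Math. 58 (1953), §5 (the Eilenberg–Zilber retraction).
* [MumfordAV1970] D. Mumford, *Abelian Varieties* (1970), §8 (vii) (p. 76) and §13 (Künneth on `X × X` for line bundles).
-/

set_option backward.isDefEq.respectTransparency false -- `Scheme.Modules`, `GradedObject` are not reducible (as in ★ `KunnethDirectSum`)

noncomputable section

universe u

open CategoryTheory CategoryTheory.Limits AlgebraicGeometry TopologicalSpace TensorProduct Opposite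
open HomologicalComplex
open scoped DirectSum

/-! ## §0 The Künneth comparison of the ordered Čech bicomplex is injective (no finiteness) -/

namespace Literature.Algebra.Homology

namespace OrderedCech

variable {A : Type u} [CommRing A] {ι κ : Type} [LinearOrder ι] [LinearOrder κ]

/-- **`Hⁿ(×)` is injective** for every pair-system `P`: the cross product `× : Tot Č•,•(P) ⟶ Č(lexSystem P)` has the Eilenberg–Zilber
retraction `∇` (★ `cross_shuffle`, `× ≫ ∇ = 𝟙`), so `Hⁿ(∇) ∘ Hⁿ(×) = id`.  (★ `bijective_homologyMap_cross` adds surjectivity under a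
finiteness hypothesis; injectivity needs none.) [cite: EilenbergMacLane1953, §5] [cite: StacksProject, Tag 0BEC] -/
theorem injective_homologyMap_cross (P : Finset ι ⥤ Finset κ ⥤ ModuleCat.{u} A) (n : ℤ) :
    Function.Injective (HomologicalComplex.homologyMap
      (totalDescHom (sysBicomplex P) (sysComplex (lexSystem P)) (fun a b n => ModuleCat.ofHom (crossComponent P a b n))
        (crossComponent_comm P)) n).hom := by
  set cr := totalDescHom (sysBicomplex P) (sysComplex (lexSystem P)) (fun a b n => ModuleCat.ofHom (crossComponent P a b n))
    (crossComponent_comm P) with hcr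
  set sh := totalLift (sysBicomplex P) (sysComplex (lexSystem P)) (isZero_sysBicomplex_X_X_of_neg_left P)
    (isZero_sysBicomplex_X_X_of_neg_right P) (fun n a b => ModuleCat.ofHom (shuffleComponent P n a b))
    (shuffleComponent_comm P) with hsh
  have hret : ∀ x, (HomologicalComplex.homologyMap sh n).hom ((HomologicalComplex.homologyMap cr n).hom x) = x := by
    intro x
    rw [← ModuleCat.comp_apply, ← HomologicalComplex.homologyMap_comp, hcr, hsh, cross_shuffle, HomologicalComplex.homologyMap_id]
    rfl
  intro x y hxy
  rw [← hret x, ← hret y, hxy]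

/-- **The Künneth comparison `Hⁿ(Č(M) ⊗ Č(N)) → Hⁿ(Č(lexSystem (M ⊠ N)))` is injective** for any two systems `M`, `N` on finite index
sets (★ `totalTensorIso` is an isomorphism, then `injective_homologyMap_cross`). [cite: StacksProject, Tag 0BEC] [cite: EilenbergMacLane1953, §5] -/
theorem injective_homologyMap_tensor_cross [Fintype ι] [Fintype κ] (M : Finset ι ⥤ ModuleCat.{u} A)
    (N : Finset κ ⥤ ModuleCat.{u} A) (n : ℤ) :
    Function.Injective (HomologicalComplex.homologyMap ((totalTensorIso M N).hom ≫
      totalDescHom (sysBicomplex (prodSystem M N)) (sysComplex (lexSystem (prodSystem M N)))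
        (fun a b n => ModuleCat.ofHom (crossComponent (prodSystem M N) a b n)) (crossComponent_comm (prodSystem M N))) n).hom := by
  rw [HomologicalComplex.homologyMap_comp, ModuleCat.hom_comp, LinearMap.coe_comp]
  refine (injective_homologyMap_cross (prodSystem M N) n).comp ?_
  exact ((HomologicalComplex.homologyFunctor _ _ n).mapIso (totalTensorIso M N)).toLinearEquiv.injective

end OrderedCech

end Literature.Algebra.Homology

/-! ## §1 The Künneth isomorphism / injection for `E ⊠ F` on the product cover -/

namespace Literature.AlgebraicGeometry.Modules

open Literature.Algebra.Homology Literature.Algebra.Homology.OrderedCech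

variable {X Y Z S : Scheme.{u}} {p : Z ⟶ X} {q : Z ⟶ Y} {iX : X ⟶ S} {iY : Y ⟶ S} {k : Type u} [Field k]
  {ι κ : Type} [LinearOrder ι] [LinearOrder κ] [Fintype ι] [Fintype κ]
  (𝓤 : ι → X.Opens) (𝓥 : κ → Y.Opens) {E : X.Modules} {F : Y.Modules}
  [IsAffine S] (H : IsPullback p q iX iY) (hU : ∀ s : Finset ι, s.Nonempty → IsAffineOpen (cechOpen 𝓤 s))
  (hV : ∀ t : Finset κ, t.Nonempty → IsAffineOpen (cechOpen 𝓥 t)) (hE : IsAffineLocalizing E) (hF : IsAffineLocalizing F)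
  (φ : k ≃+* Γ(S, ⊤))
  (W : ι ×ₗ κ → Z.Opens) (hW : ∀ i j, W (toLex (i, j)) = p ⁻¹ᵁ 𝓤 i ⊓ q ⁻¹ᵁ 𝓥 j)

include H hU hV hE hF hW in
/-- **Künneth on the product cover for `E ⊠ F`**: for a cartesian square `Z = X ×_S Y` over an affine base with `φ : k ≃ Γ(S, 𝒪_S)` (`k` a
field), finite covers `𝓤`, `𝓥` with affine non-empty finite intersections, quasi-coherent `E`, `F`, the product cover
`W (i, j) = p⁻¹U_i ∩ q⁻¹V_j` and `Ȟⁿ(W, E ⊠ F)` finite-dimensional, there is a `k`-linear isomorphism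
`⨁_{a+b=n} Ȟᵃ(𝓤, E) ⊗ₖ Ȟᵇ(𝓥, F) ≃ Ȟⁿ(W, E ⊠ F)` (★ `kunnethLinearEquiv`, then `Hⁿ` of `totalTensorIso ≫ ×`, then `Hⁿ` of the carrier
isomorphism ★ `exists_sysComplex_lexSystem_prodSystem_iso_cechComplex`; bijective by ★ `bijective_homologyMap_comp_kunnethLinearEquiv`).
[cite: StacksProject, Tag 0BEC] [cite: GortzWedhorn2023, Cor. 22.110] [cite: Weibel1994, Thm. 3.6.3] -/
theorem nonempty_directSum_tensor_linearEquiv_homology_boxTensor (n : ℤ)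
    [Module.Finite k ((cechComplex W (boxTensor p q E F) (overRingHom (p ≫ iX) φ)).homology n)] :
    Nonempty ((⨁ (r : {r : ℤ × ℤ // r.1 + r.2 = n}),
        (((cechComplex 𝓤 E (overRingHom iX φ)).homology r.1.1 : Type u) ⊗[k]
          ((cechComplex 𝓥 F (overRingHom iY φ)).homology r.1.2 : Type u))) ≃ₗ[k]
      ((cechComplex W (boxTensor p q E F) (overRingHom (p ≫ iX) φ)).homology n : Type u)) := by
  obtain rfl : W = fun c : ι ×ₗ κ => p ⁻¹ᵁ 𝓤 (ofLex c).1 ⊓ q ⁻¹ᵁ 𝓥 (ofLex c).2 := funext fun c => hW (ofLex c).1 (ofLex c).2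
  obtain ⟨e, -⟩ := exists_sysComplex_lexSystem_prodSystem_iso_cechComplex 𝓤 𝓥 H hU hV hE hF φ
  haveI := isStrictlyGE_cechComplex 𝓤 E (overRingHom iX φ)
  haveI := isStrictlyLE_cechComplex 𝓤 E (overRingHom iX φ) (Fintype.card ι : ℤ) (by omega)
  haveI := isStrictlyGE_cechComplex 𝓥 F (overRingHom iY φ)
  haveI := isStrictlyLE_cechComplex 𝓥 F (overRingHom iY φ) (Fintype.card κ : ℤ) (by omega)
  have hΦ := bijective_homologyMap_comp_kunnethLinearEquiv (sectionsSystem 𝓤 E (overRingHom iX φ))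
    (sectionsSystem 𝓥 F (overRingHom iY φ)) e 0 (Fintype.card ι : ℤ) 0 (Fintype.card κ : ℤ) n
  exact ⟨LinearEquiv.ofBijective _ hΦ⟩

include H hU hV hE hF hW in
/-- **The Künneth INJECTION for `E ⊠ F` on the product cover, no finiteness**: in the setting of
`nonempty_directSum_tensor_linearEquiv_homology_boxTensor` but WITHOUT assuming `Ȟⁿ(W, E ⊠ F)` finite-dimensional, the Künneth comparison
`⨁_{a+b=n} Ȟᵃ(𝓤, E) ⊗ₖ Ȟᵇ(𝓥, F) → Ȟⁿ(W, E ⊠ F)` is an injective `k`-linear map (§0: the cross product is a split monomorphism).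
[cite: StacksProject, Tag 0BEC] [cite: EilenbergMacLane1953, §5] [cite: Weibel1994, Thm. 3.6.3] -/
theorem exists_injective_directSum_tensor_homology_boxTensor (n : ℤ) :
    ∃ Φ : (⨁ (r : {r : ℤ × ℤ // r.1 + r.2 = n}),
        (((cechComplex 𝓤 E (overRingHom iX φ)).homology r.1.1 : Type u) ⊗[k]
          ((cechComplex 𝓥 F (overRingHom iY φ)).homology r.1.2 : Type u))) →ₗ[k]
      ((cechComplex W (boxTensor p q E F) (overRingHom (p ≫ iX) φ)).homology n : Type u), Function.Injective Φ := by
  obtain rfl : W = fun c : ι ×ₗ κ => p ⁻¹ᵁ 𝓤 (ofLex c).1 ⊓ q ⁻¹ᵁ 𝓥 (ofLex c).2 := funext fun c => hW (ofLex c).1 (ofLex c).2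
  obtain ⟨e, -⟩ := exists_sysComplex_lexSystem_prodSystem_iso_cechComplex 𝓤 𝓥 H hU hV hE hF φ
  haveI := isStrictlyGE_cechComplex 𝓤 E (overRingHom iX φ)
  haveI := isStrictlyLE_cechComplex 𝓤 E (overRingHom iX φ) (Fintype.card ι : ℤ) (by omega)
  haveI := isStrictlyGE_cechComplex 𝓥 F (overRingHom iY φ)
  haveI := isStrictlyLE_cechComplex 𝓥 F (overRingHom iY φ) (Fintype.card κ : ℤ) (by omega)
  refine ⟨(HomologicalComplex.homologyMap e.hom n).hom ∘ₗ
    (HomologicalComplex.homologyMap ((totalTensorIso (sectionsSystem 𝓤 E (overRingHom iX φ))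
        (sectionsSystem 𝓥 F (overRingHom iY φ))).hom ≫
      totalDescHom (sysBicomplex (prodSystem (sectionsSystem 𝓤 E (overRingHom iX φ)) (sectionsSystem 𝓥 F (overRingHom iY φ))))
        (sysComplex (lexSystem (prodSystem (sectionsSystem 𝓤 E (overRingHom iX φ)) (sectionsSystem 𝓥 F (overRingHom iY φ)))))
        (fun a b n => ModuleCat.ofHom (crossComponent
          (prodSystem (sectionsSystem 𝓤 E (overRingHom iX φ)) (sectionsSystem 𝓥 F (overRingHom iY φ))) a b n))
        (crossComponent_comm _)) n).hom ∘ₗ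
    (kunnethLinearEquiv (sysComplex (sectionsSystem 𝓤 E (overRingHom iX φ))) (sysComplex (sectionsSystem 𝓥 F (overRingHom iY φ)))
      0 (Fintype.card ι : ℤ) 0 (Fintype.card κ : ℤ) n).toLinearMap, ?_⟩
  rw [LinearMap.coe_comp, LinearMap.coe_comp]
  exact ((HomologicalComplex.homologyFunctor _ _ n).mapIso e).toLinearEquiv.injective.comp
    ((injective_homologyMap_tensor_cross _ _ n).comp
      (kunnethLinearEquiv (sysComplex (sectionsSystem 𝓤 E (overRingHom iX φ)))
        (sysComplex (sectionsSystem 𝓥 F (overRingHom iY φ))) 0 (Fintype.card ι : ℤ) 0 (Fintype.card κ : ℤ) n).injective)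

/-! ## §2 One bidegree: the Künneth injection, and Künneth vanishing -/

include H hU hV hE hF hW in
/-- **The Künneth injection of one bidegree**: `Ȟᵃ(𝓤, E) ⊗ₖ Ȟᵇ(𝓥, F) ↪ Ȟᵃ⁺ᵇ(W, E ⊠ F)`, `k`-linearly, for the product cover `W` of a
cartesian square over an affine base (no finiteness needed).  With `E = 𝒪_X`, `a = 0` this is how a non-zero `Ȟᵇ(𝓥, F)` is seen inside
`Ȟᵇ(X ×_S Y, p^*𝒪 ⊗ q^*F)` ([MumfordAV1970] §8 (vii)). [cite: StacksProject, Tag 0BEC] [cite: MumfordAV1970, §8 (vii) (p. 76)] -/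
theorem exists_injective_tensor_homology_boxTensor (a b n : ℤ) (h : a + b = n) :
    ∃ Φ : ((cechComplex 𝓤 E (overRingHom iX φ)).homology a : Type u) ⊗[k] ((cechComplex 𝓥 F (overRingHom iY φ)).homology b : Type u)
        →ₗ[k] ((cechComplex W (boxTensor p q E F) (overRingHom (p ≫ iX) φ)).homology n : Type u),
      Function.Injective Φ := by
  obtain ⟨Φ, hΦ⟩ := exists_injective_directSum_tensor_homology_boxTensor 𝓤 𝓥 H hU hV hE hF φ W hW n
  refine ⟨Φ ∘ₗ DirectSum.lof k {r : ℤ × ℤ // r.1 + r.2 = n}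
    (fun r => ((cechComplex 𝓤 E (overRingHom iX φ)).homology r.1.1 : Type u) ⊗[k]
      ((cechComplex 𝓥 F (overRingHom iY φ)).homology r.1.2 : Type u)) ⟨(a, b), h⟩, ?_⟩
  rw [LinearMap.coe_comp]
  exact hΦ.comp (DirectSum.of_injective (β := fun r : {r : ℤ × ℤ // r.1 + r.2 = n} =>
    ((cechComplex 𝓤 E (overRingHom iX φ)).homology r.1.1 : Type u) ⊗[k]
      ((cechComplex 𝓥 F (overRingHom iY φ)).homology r.1.2 : Type u)) ⟨(a, b), h⟩)

include H hU hV hE hF hW in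
/-- If `Ȟⁿ(W, E ⊠ F) = 0` then every `Ȟᵃ(𝓤, E) ⊗ₖ Ȟᵇ(𝓥, F)` with `a + b = n` vanishes (the Künneth injection of
`exists_injective_tensor_homology_boxTensor`). [cite: StacksProject, Tag 0BEC] [cite: GortzWedhorn2023, Cor. 22.110] -/
theorem subsingleton_tensor_homology_of_subsingleton_homology_boxTensor (a b n : ℤ) (h : a + b = n)
    [Subsingleton ((cechComplex W (boxTensor p q E F) (overRingHom (p ≫ iX) φ)).homology n)] :
    Subsingleton (((cechComplex 𝓤 E (overRingHom iX φ)).homology a : Type u) ⊗[k]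
      ((cechComplex 𝓥 F (overRingHom iY φ)).homology b : Type u)) := by
  obtain ⟨Φ, hΦ⟩ := exists_injective_tensor_homology_boxTensor 𝓤 𝓥 H hU hV hE hF φ W hW a b n h
  exact hΦ.subsingleton

include H hU hV hE hF hW in
/-- **Künneth vanishing for `E ⊠ F` on the product cover**: if `Ȟᵃ(𝓤, E) ⊗ₖ Ȟᵇ(𝓥, F) = 0` for all `a + b = n` and `Ȟⁿ(W, E ⊠ F)` is
finite-dimensional (e.g. `Z` proper over `Spec k` and `E ⊠ F` coherent), then `Ȟⁿ(W, E ⊠ F) = 0` — the step «by Künneth,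
`H^k(X × X, p₁^*L ⊗ p₂^*M) = Σ_{i+j=k} Hⁱ(X, L) ⊗ Hʲ(X, M)` vanishes» of [MumfordAV1970] §8 (vii).
[cite: MumfordAV1970, §8 (vii) (p. 76)] [cite: StacksProject, Tag 0BEC] [cite: GortzWedhorn2023, Cor. 22.110] -/
theorem subsingleton_homology_boxTensor_of_forall (n : ℤ)
    [Module.Finite k ((cechComplex W (boxTensor p q E F) (overRingHom (p ≫ iX) φ)).homology n)]
    (h0 : ∀ a b : ℤ, a + b = n → Subsingleton (((cechComplex 𝓤 E (overRingHom iX φ)).homology a : Type u) ⊗[k]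
      ((cechComplex 𝓥 F (overRingHom iY φ)).homology b : Type u))) :
    Subsingleton ((cechComplex W (boxTensor p q E F) (overRingHom (p ≫ iX) φ)).homology n) := by
  obtain ⟨Ψ⟩ := nonempty_directSum_tensor_linearEquiv_homology_boxTensor 𝓤 𝓥 H hU hV hE hF φ W hW n
  haveI : ∀ r : {r : ℤ × ℤ // r.1 + r.2 = n}, Subsingleton (((cechComplex 𝓤 E (overRingHom iX φ)).homology r.1.1 : Type u) ⊗[k]
      ((cechComplex 𝓥 F (overRingHom iY φ)).homology r.1.2 : Type u)) := fun r => h0 r.1.1 r.1.2 r.2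
  haveI : Subsingleton (⨁ (r : {r : ℤ × ℤ // r.1 + r.2 = n}),
      (((cechComplex 𝓤 E (overRingHom iX φ)).homology r.1.1 : Type u) ⊗[k]
        ((cechComplex 𝓥 F (overRingHom iY φ)).homology r.1.2 : Type u))) := inferInstance
  exact Ψ.symm.injective.subsingleton

end Literature.AlgebraicGeometry.Modules

end
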